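import Summits.QuantumFields.YangMills.Theorems.BalabanUVNodesN07HalvingStepTopCoreOfLocalLetters
import Summits.QuantumFields.YangMills.Theorems.BalabanUVNodesK0HalvingStepOfCore

/-!
# K0⁷ — THE CORE-LETTER SOCKETS FOR STUB 1: V18 `stub_prop8StepCoP13`'s registered body, and K0⁷'s body at every family, from the ∃-gauge letter tokens of
# [15] Sect. F asked ONLY at the core plaquettes ∕ bonds (dag-n07-w4's `LocalLetters167TopStepCore` ∕ `LocalLetters165TopStepCore`), BY NAME

Cell `pub-ymgap`, seat `pub-ymgap-k0-s1-w3` generation 0 (D-0149 width seat 3∕3 on K0⁷ `stmt-QuantumFields-20541`; INTENT-4 of 2026-08-27; dag-n07-w4 g0 «YOURS, go ahead»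
INBOX l.25134).  `--kind proof --supports stmt-QuantumFields-20541 --as helper`.  NEW leaf, THEOREMS ONLY (0 def), nothing modified; no new named fact.  CONSUMED BY NAME:
dag-n07-w4 `N07HalvingStepTopCoreOfLocalLetters.(halvingStepTopCore_of_localLetters167Core, halvingStepTopCore_of_localLetters165Core)` (p587134 ✓), this seat's
`K0HalvingStepOfCore.(halvingStepTop_of_core, suppDomOfRecord_one_subset, prop8StepCoP_of_core, record13SepCoPHBody_of_core23A)` (p586684 ✓; underneath: dag-n07-e module 30's
iteration and dag-n21-c's sockets p582553).  Sibling (NON-core tokens, floor `0 < B₃`): dag-n21-c `K0LocalLettersSocket` (p586773 ✓).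
[15] = [Balaban1985Variational]; [6] = [Balaban1985RegularSpaces]; [III] = [Balaban1988Convergent]; [I] = [Balaban1987RG1].

WHAT THIS FILE SAYS (for the Sect.-F suppliers S1–S6 and the plan desk's skeleton note).  After this file a seat that lands, for every family `F`, constants with
`2L² ≤ B₃`, `128C ≤ B₃`, `512θ ≤ 1`, `0 ≤ Q`, `512·Q·a₀ ≤ 1`, `0 < a₀ ≤ ½`, `0 < a₁` and the CORE (165)-letter token
`LocalLetters165TopStepCore F 2 (fun ν K Ω => suppDomOfRecord F ν K Ω) B₃ C θ Q a₀ a₁` — i.e. [15] (165)'s letters `|A|, |∇A|, |∂*∂A| ≤ C·δ_i + θ·ε_i + Q·ε_i²` in SOME local gauge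
around every plaquette WITH A BOND INSIDE `Ω₁` and every bond WHOSE STENCIL MEETS `Ω₁` (print p. 302: «a unit cube Δ₀ ⊂ B_j(Λ_j) containing p or b»), and NOTHING at the pinned pure-data
plaquettes ∕ far bonds — closes `stub_prop8StepCoP13` in one line (`prop8StepCoP_of_localLetters165Core`), and K0⁷'s body on every `F` follows with stubs 2 ∕ 3ᴬ verbatim
(`record13SepCoPHBody_of_localLetters165Core_23A`).  The floor `2L² ≤ B₃` (instead of the sibling's `0 < B₃`) is the price of the core restriction: it is spent on the
pure-data corner plaquettes of `Ω₁` at level `1` (`K0HalvingStepOfCore.halvingStepTop_of_core`) — and it is the registered stub's own conjunct, so nothing is lost.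

CONTENTS.  §1 `prop8StepCoP_of_localLetters167Core`, ★ `prop8StepCoP_of_localLetters165Core` (stub 1's registered body).  §2 `record13SepCoPHBody_of_localLetters167Core_23A`,
★ `record13SepCoPHBody_of_localLetters165Core_23A` (K0⁷'s body on every family; `h2`, `h3A` = V18's stubs 2, 3ᴬ VERBATIM).

HONEST FRAMING ∕ A6.  By-name doors, CONDITIONAL: the antecedents are ∃-gauge letter TOKENS (hypotheses, NEVER asserted; their discharge is [15] Sect. F (144)–(167) at NODE 00's
objects = sub-targets S1–S6, open) whose binder block is `HalvingStepTop`'s, inhabited by dag-n07-e module 32's flat witness (and the core conclusion by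
`K0HalvingStepOfCore.halvingStepTopCore_binders_inhabited_flat`); nothing of Bałaban asserted; K0⁷ ∕ stub 1 NOT closed; N07 NOT discharged; counts unmoved (28∕28 · 5∕27); one finite
𝕋⁴ programme at fixed ε; R4 closes the conditional finite-𝕋⁴ rung `BalabanLadder.UV` only — the YM mass gap (Clay) is NOT proved by any of this; nothing continuum ∕ ℝ⁴ ∕ OS.
-/

noncomputable section

namespace Summit.QuantumFields.YangMills.Theorems.K0LocalLettersCoreSocket

open scoped Matrix.Norms.L2Operator
open Literature.MathematicalPhysics.QuantumFieldTheory.Balaban1983to89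
open Literature.MathematicalPhysics.QuantumFieldTheory.Balaban1983to89.Node00
open Literature.MathematicalPhysics.QuantumFieldTheory.Balaban1983to89.T4Continuum
open Literature.MathematicalPhysics.QuantumFieldTheory.Balaban1983to89.FlowStep
open Summit.QuantumFields.YangMills.BalabanUVNodes.N07HalvingStepTopOfLocalLetters (LocalLetters167TopStep LocalLetters165TopStep)
open Summit.QuantumFields.YangMills.BalabanUVNodes.N07HalvingStepTopCoreOfLocalLetters
  (LocalLetters167TopStepCore LocalLetters165TopStepCore halvingStepTopCore_of_localLetters167Core halvingStepTopCore_of_localLetters165Core)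
open Summit.QuantumFields.YangMills.Theorems.K0HalvingStepOfCore
  (halvingStepTop_of_core suppDomOfRecord_one_subset prop8StepCoP_of_core record13SepCoPHBody_of_core23A)

/-! ## §1  Stub 1's registered body from the CORE letter tokens -/

section StubOne

variable (F : T4Family)

/-- **STUB 1's REGISTERED BODY FROM THE CORE (167)-LETTER TOKEN**: [15] (167)'s letters in a local gauge around every core plaquette ∕ bond of the top class (dag-n07-w4's
`LocalLetters167TopStepCore`, `a₀ ≤ ½`) give the core one-step fact (`halvingStepTopCore_of_localLetters167Core`), whence — support containing `Ω₁`, floor `2L² ≤ B₃` —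
[15] Prop. 8's top step at the record's support selector with the floor displayed (`K0HalvingStepOfCore.prop8StepCoP_of_core`): V18's `Prop8StepCoPAt F` verbatim.
[cite: Balaban1985Variational, (167)–(168) p.304, Prop. 8 p.304, Sect. F pp.300–304; Balaban1985RegularSpaces, (1.7)–(1.9) p.77 (bookkeeping)] -/
theorem prop8StepCoP_of_localLetters167Core {B₃ a₀ a₁ : ℝ} (hB₃ : 2 * (F.L : ℝ) ^ 2 ≤ B₃) (ha₀ : 0 < a₀) (ha₀' : 2 * a₀ ≤ 1) (ha₁ : 0 < a₁)
    (h : LocalLetters167TopStepCore F 2 (fun ν K Ω => suppDomOfRecord F ν K Ω) B₃ a₀ a₁) :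
    ∃ B₃ a₀ a₁ : ℝ, 2 * (F.L : ℝ) ^ 2 ≤ B₃ ∧ 0 < a₀ ∧ 0 < a₁ ∧ Prop8RegSepTopStep F 2 (fun ν K Ω => suppDomOfRecord F ν K Ω) B₃ a₀ a₁ := by
  have hL11 : (11 : ℝ) < F.L := by exact_mod_cast F.hL11
  have hB₃0 : 0 ≤ B₃ := by nlinarith
  exact prop8StepCoP_of_core F ⟨B₃, a₀, a₁, hB₃, ha₀, ha₁, halvingStepTopCore_of_localLetters167Core h hB₃0 ha₀'⟩

/-- ★ **STUB 1's REGISTERED BODY FROM THE CORE (165)-LETTER TOKEN**: [15] (165)'s budget letters `C·δ_i + θ·ε_i + Q·ε_i²` in a local gauge around every core plaquette ∕ bond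
(dag-n07-w4's `LocalLetters165TopStepCore`), with print's (162)∕(166) smallness in the tree's constants (`128C ≤ B₃`, `512θ ≤ 1`, `512·Q·a₀ ≤ 1`, `a₀ ≤ ½`) and the floor `2L² ≤ B₃`,
give V18's `Prop8StepCoPAt F` verbatim (`halvingStepTopCore_of_localLetters165Core` ⇒ `halvingStepTop_of_core` ⇒ module 30 ⇒ n21-c's socket).
[cite: Balaban1985Variational, (165)–(168) p.304, (162)–(163) pp.303–304, Prop. 8 p.304; Balaban1985RegularSpaces, (1.7)–(1.9) p.77 (bookkeeping)] -/
theorem prop8StepCoP_of_localLetters165Core {B₃ C θ Q a₀ a₁ : ℝ} (hB₃ : 2 * (F.L : ℝ) ^ 2 ≤ B₃) (hC : 128 * C ≤ B₃) (hθ : 512 * θ ≤ 1) (hQ : 0 ≤ Q)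
    (ha : 512 * Q * a₀ ≤ 1) (ha₀ : 0 < a₀) (ha₀' : 2 * a₀ ≤ 1) (ha₁ : 0 < a₁)
    (h : LocalLetters165TopStepCore F 2 (fun ν K Ω => suppDomOfRecord F ν K Ω) B₃ C θ Q a₀ a₁) :
    ∃ B₃ a₀ a₁ : ℝ, 2 * (F.L : ℝ) ^ 2 ≤ B₃ ∧ 0 < a₀ ∧ 0 < a₁ ∧ Prop8RegSepTopStep F 2 (fun ν K Ω => suppDomOfRecord F ν K Ω) B₃ a₀ a₁ := by
  have hL11 : (11 : ℝ) < F.L := by exact_mod_cast F.hL11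
  have hB₃0 : 0 ≤ B₃ := by nlinarith
  exact prop8StepCoP_of_core F ⟨B₃, a₀, a₁, hB₃, ha₀, ha₁, halvingStepTopCore_of_localLetters165Core h hB₃0 hC hθ hQ ha ha₀'⟩

end StubOne

/-! ## §2  K0⁷'s body at every family from the CORE letter tokens, stubs 2 and 3ᴬ verbatim -/

section Composition

/-- **K0⁷'s BODY AT EVERY FAMILY FROM THE CORE (167)-LETTER TOKEN, STUBS 2 AND 3ᴬ VERBATIM** (Cʷ″ through `K0HalvingStepOfCore.record13SepCoPHBody_of_core23A`).  CONDITIONAL;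
K0⁷ NOT closed here. [cite: Balaban1985Variational, (167)–(168) p.304, Prop. 8 p.304; Balaban1985RegularSpaces, Prop. 6 p.99; Balaban1988Convergent, Thm 1 p.262; Balaban1987RG1, Thm 1 p.259, §1 p.264 (bookkeeping)] -/
theorem record13SepCoPHBody_of_localLetters167Core_23A
    (h1 : ∀ F : T4Family, ∃ B₃ a₀ a₁ : ℝ, 2 * (F.L : ℝ) ^ 2 ≤ B₃ ∧ 0 < a₀ ∧ 2 * a₀ ≤ 1 ∧ 0 < a₁ ∧
      LocalLetters167TopStepCore F 2 (fun ν K Ω => suppDomOfRecord F ν K Ω) B₃ a₀ a₁)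
    (h2 : ∀ F : T4Family, ∃ B₁ c₁ : ℝ, 0 ≤ B₁ ∧ 0 < c₁ ∧
      (letI : CStarAlgebra (MatA 2) := {}; B8.Prop6Printed 4 (F.L : ℝ) B₁ c₁ (fun i : B8LeafModelZd.ZdIdx 4 F.L => zdCub (MatA 2) F.L i)))
    (h3A : ∀ (F : T4Family) (B₃ B₃' a₀ a₁ : ℝ), 2 * (F.L : ℝ) ^ 2 ≤ B₃ → 0 < B₃' → 0 < a₀ → 0 < a₁ →
      VariationalThm1RegSepCoP7M F 2 B₃ a₀ a₁ →
      Gauge9RegSepTopStepR F 2 (fun ν K Ω => suppDomOfRecord F ν K Ω) (F.L ^ 3) ((11 * 4 + 3 * F.L) * F.L) B₃ B₃' a₀ a₁ →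
      ∃ γ₀ ε₀ ε₂₉ β' : ℝ, 0 < γ₀ ∧ 0 < ε₀ ∧ 0 < ε₂₉ ∧
        BetaLowerH (-β') γ₀ (betaOfRecord₁₃ F 2 (theta13OfThm1CCM F 2 3 ε₀ ε₂₉ B₃ B₃' a₀ a₁)) ∧
        BetaUpperH β' γ₀ (betaOfRecord₁₃ F 2 (theta13OfThm1CCM F 2 3 ε₀ ε₂₉ B₃ B₃' a₀ a₁))) :
    ∀ F : T4Family, ∃ θ : Stage13HParams F 2, θ.Provisos₁₃SepCoPH F 2 ∧ (θ.ZhUnity F 2 ∧ θ.SlotsNondegenerate₁₃ F 2) ∧ θ.Admissible F 2 :=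
  record13SepCoPHBody_of_core23A (fun F => by
    obtain ⟨B₃, a₀, a₁, hB₃, ha₀, ha₀', ha₁, h⟩ := h1 F
    have hL11 : (11 : ℝ) < F.L := by exact_mod_cast F.hL11
    exact ⟨B₃, a₀, a₁, hB₃, ha₀, ha₁, halvingStepTopCore_of_localLetters167Core h (by nlinarith) ha₀'⟩) h2 h3A

/-- ★ **K0⁷'s BODY AT EVERY FAMILY FROM THE CORE (165)-LETTER TOKEN, STUBS 2 AND 3ᴬ VERBATIM** — the reduced signature of record for the Sect.-F suppliers in the
core currency (dag-n07-w4 l.25134): `h1` = for every `F`, constants with `2L² ≤ B₃`, `128C ≤ B₃`, `512θ ≤ 1`, `0 ≤ Q`, `512·Q·a₀ ≤ 1`, `0 < a₀ ≤ ½`, `0 < a₁` and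
`LocalLetters165TopStepCore F 2 suppDom B₃ C θ Q a₀ a₁`; `h2`, `h3A` = V18's stubs 2, 3ᴬ VERBATIM.  CONDITIONAL; K0⁷ NOT closed here; nothing of Bałaban asserted.
[cite: Balaban1985Variational, (165)–(168) p.304, (162)–(163) pp.303–304, Prop. 8 p.304; Balaban1985RegularSpaces, Prop. 6 p.99; Balaban1988Convergent, Thm 1 p.262; Balaban1987RG1, Thm 1 p.259, §1 p.264 (bookkeeping)] -/
theorem record13SepCoPHBody_of_localLetters165Core_23A
    (h1 : ∀ F : T4Family, ∃ B₃ C θ Q a₀ a₁ : ℝ, 2 * (F.L : ℝ) ^ 2 ≤ B₃ ∧ 128 * C ≤ B₃ ∧ 512 * θ ≤ 1 ∧ 0 ≤ Q ∧ 512 * Q * a₀ ≤ 1 ∧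
      0 < a₀ ∧ 2 * a₀ ≤ 1 ∧ 0 < a₁ ∧ LocalLetters165TopStepCore F 2 (fun ν K Ω => suppDomOfRecord F ν K Ω) B₃ C θ Q a₀ a₁)
    (h2 : ∀ F : T4Family, ∃ B₁ c₁ : ℝ, 0 ≤ B₁ ∧ 0 < c₁ ∧
      (letI : CStarAlgebra (MatA 2) := {}; B8.Prop6Printed 4 (F.L : ℝ) B₁ c₁ (fun i : B8LeafModelZd.ZdIdx 4 F.L => zdCub (MatA 2) F.L i)))
    (h3A : ∀ (F : T4Family) (B₃ B₃' a₀ a₁ : ℝ), 2 * (F.L : ℝ) ^ 2 ≤ B₃ → 0 < B₃' → 0 < a₀ → 0 < a₁ →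
      VariationalThm1RegSepCoP7M F 2 B₃ a₀ a₁ →
      Gauge9RegSepTopStepR F 2 (fun ν K Ω => suppDomOfRecord F ν K Ω) (F.L ^ 3) ((11 * 4 + 3 * F.L) * F.L) B₃ B₃' a₀ a₁ →
      ∃ γ₀ ε₀ ε₂₉ β' : ℝ, 0 < γ₀ ∧ 0 < ε₀ ∧ 0 < ε₂₉ ∧
        BetaLowerH (-β') γ₀ (betaOfRecord₁₃ F 2 (theta13OfThm1CCM F 2 3 ε₀ ε₂₉ B₃ B₃' a₀ a₁)) ∧
        BetaUpperH β' γ₀ (betaOfRecord₁₃ F 2 (theta13OfThm1CCM F 2 3 ε₀ ε₂₉ B₃ B₃' a₀ a₁))) :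
    ∀ F : T4Family, ∃ θ : Stage13HParams F 2, θ.Provisos₁₃SepCoPH F 2 ∧ (θ.ZhUnity F 2 ∧ θ.SlotsNondegenerate₁₃ F 2) ∧ θ.Admissible F 2 :=
  record13SepCoPHBody_of_core23A (fun F => by
    obtain ⟨B₃, C, θ, Q, a₀, a₁, hB₃, hC, hθ, hQ, ha, ha₀, ha₀', ha₁, h⟩ := h1 F
    have hL11 : (11 : ℝ) < F.L := by exact_mod_cast F.hL11
    exact ⟨B₃, a₀, a₁, hB₃, ha₀, ha₁, halvingStepTopCore_of_localLetters165Core h (by nlinarith) hC hθ hQ ha ha₀'⟩) h2 h3A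

end Composition

end Summit.QuantumFields.YangMills.Theorems.K0LocalLettersCoreSocket

end
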